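import Mathlib
import Literature.MathematicalPhysics.QuantumFieldTheory.Balaban1983to89.B6RandomWalk

/-!
# `Balaban1983to89.B6Geometry` — [Balaban1984PropagatorsII] Sect. A pp. 224, 231–234: the multiscale distance
d(y, y′) (2.46) TYPED (admissible contours = walks in the graph of admissible bonds), its triangle inequality (2.54),
d(y, y) = 0, d ≥ 0 KERNEL-CHECKED from the definition, and the geometric half (2.60) of Lemma 2.1 KERNEL-DERIVED from
the walk form of condition (2.2)/(2.57)

CITATION HEADER (lean-in-tree rule 2026-08-18).  Source: T. Bałaban, *Propagators and renormalization transformations for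
lattice gauge theories. II*, Commun. Math. Phys. **96**, 223–250 (1984), doi:10.1007/bf01240221 (cell paper B6; held:
`paper:balaban1984-cmp96-propagators-rt-ii`; journal page = PDF page + 222; every quotation below is read from the page
renders pp. 224, 231, 232, 233, 234 [PDF 2, 9, 10, 11, 12], `b2b-balaban-ref1/pages/1984-cmp96-propagators-rt-II/…-p002,
p009, p010, p011, p012-x2.png`).  Companion of the sibling modules `…Balaban1983to89.B6` (r1/b06: the abstract carrier
`B6.Geometry` with the UNSPECIFIED fields `dist : Site → Site → ℝ` and `Hyp21_22 : Prop`, and `B6.Lemma21Printed` =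
(2.60) ∧ (2.61)) and `…Balaban1983to89.B6RandomWalk` (pv08: `Ineq260`, `Ineq261`, `Triangle254`, and the kernel chains
of Lemma 2.1 / Prop. 2.2 / Prop. 2.6, which take the triangle inequality (2.54), d(y, y) = 0 and d ≥ 0 as HYPOTHESES
`htri`, `hrefl`, `hdnn` — cell GAPS.md G-pv08-2 (ii)); NEITHER sibling is modified.

THE PRINTED DEFINITIONS (verbatim).  p. 224 [2]: *"We consider a sequence of domains Ω₁ ⊃ Ω₂ ⊃ … ⊃ Ω_k, Ω_j ⊂ T_η,
j = 1, 2, …, k, (2.1) which satisfy the following conditions: Ω_j = B^j(Ω_j^{(j)}), Ω_j^{(j)} ⊂ T^{(j)}_{L^jη} and it is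
a sum of big blocks, (L^jη)^{−1} dist(Ω_j^c, Ω_{j+1}) > RM, M is a size of big blocks and R is a big positive integer
which will be fixed later. (2.2)"*; *"Let us define Λ_j = Ω_j^{(j)}∖Ω_{j+1}^{(j)}, j = 1, …, k − 1, Λ_k = Ω_k^{(k)},
Λ₀ = Ω₁^c (2.3) for the sets of sites and the sets of bonds; thus we have Ω₁ = ⋃_{j=1}^k B^j(Λ_j), T = ⋃_{j=0}^k B^j(Λ_j),
where B⁰(Λ₀) = Λ₀. (2.4)"*.  p. 231 [9]: *"Let us denote 𝔅 = ⋃_{j=0}^k Λ_j. (2.45) We will identify this set with the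
set of corresponding blocks. For an arbitrary contour Γ on the lattice T_η we put |Γ| = nη, where n is a number of
bonds the contour Γ consists of. We will define a new distance between two points of 𝔅. We consider a special class
of contours Γ. They have the property that a part of Γ contained in B^j(Λ_j) consists of bonds of the lattice Λ_j. Now
we define d(y, y′) = inf_{Γ_{y,y′}} Σ_{j=0}^k (L^jη)^{−1}|Γ_{y,y′} ∩ B^j(Λ_j)|, y, y′ ∈ 𝔅, (2.46) where the infimum is
taken over all admissible contours described above, with end-points, y, y′. We may extend this definition and define
the distance for a pair of arbitrary points x, x′ ∈ T_η putting d(x, x′) = d(y^j(x), y^{j′}(x′)) if x ∈ B^j(Λ_j),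
x′ ∈ B^{j′}(Λ_{j′})."*; *"The domain Ω_j is a sum of cubes of the size ML^jη. A sum of faces of these cubes which are
not contained in the interior of Ω_j forms a surface. We denote this surface by Σ_j … The surface Σ_j separates the sets
B^j(Λ_j) and B^{j−1}(Λ_{j−1}). Now let us consider the definition (2.46). Of course the infimum is attained at some
contour Γ_{y,y′}."*; the decomposition of a minimising contour: *"Γ_{y,y′} = Γ_{y,y₁} ∪ ⋃_{l=1}^m (Γ_{y_l,y′_l} ∪
Γ_{y′_l,y_{l+1}}), y_{m+1} = y′, (2.47) y_l, y′_l ∈ Σ_{j_l}, Γ_{y_l,y′_l} does not intersect any other surface Σ_j,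
j ≠ j_l, Γ_{y′_l,y_{l+1}} connects the surface Σ_{j_l} with the surface Σ_{j_{l+1}} and is contained in
B^{j_{l,l+1}}(Λ_{j_{l,l+1}}), where j_{l,l+1} = min{j_l, j_{l+1}}, |j_l − j_{l+1}| = 1."*  p. 232 [10]: *"From this
decomposition and the definition (2.46) we get d(y, y′) ≥ (L^jη)^{−1}|Γ_{y,y₁}| + Σ_{l=1}^m (L^{j_l}η)^{−1}|Γ_{y_l,y′_l}| +
Σ_{l=1}^m (L^{j_{l,l+1}}η)^{−1}|Γ_{y′_l,y_{l+1}}| ≥ (L^jη)^{−1}|y − y₁| + Σ_{l=1}^m (L^{j_l}η)^{−1}|y_l − y′_l| +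
Σ_{l=1}^m (L^{j_{l,l+1}}η)^{−1}|y′_l − y_{l+1}|. (2.48)"*  p. 233 [11]: *"Taking the contour Γ_{y,y′} = ⋃_{i=0}^{n−1} Γ_{y_i,y_{i+1}}, where y₀ = y, y_n = y′,
we obtain an admissible contour with end-points y, y′, hence by definition (2.46) we have d(y, y₁) + d(y₁, y₂) + … +
d(y_{n−1}, y′) ≥ d(y, y′). (2.54) This is of course the triangle inequality for our distance."*; *"From the condition
(2.2) and from the definition of the points y′_l, y_{l+1}, more exactly from the fact that they belong to different
surfaces Σ_j, we have (L^{j_{l,l+1}}η)^{−1}|y′_l − y_{l+1}| > RM. (2.57)"*.  p. 234 [12], Lemma 2.1: *"e^{−αδ₀d(y,y′)} ≤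
e^{−αδ₀RM max{|j−j′|−1,0}}, y ∈ Λ_j, y′ ∈ Λ_{j′}, (2.60)"*.

TYPING (dictionary print ↔ Lean; cell DIVERGENCE.md D-pv08g2.1).  An admissible contour is a finite chain of ADMISSIBLE
BONDS: a bond b of the lattice Λ_j (spacing L^jη) lying in B^j(Λ_j) consists of L^j bonds of T_η, so |b| = L^j·η and its
summand in (2.46) is (L^jη)^{−1}|b| = 1 EXACTLY; hence Σ_j (L^jη)^{−1}|Γ ∩ B^j(Λ_j)| = the NUMBER of admissible bonds of
Γ, and (2.46) is the graph distance (least number of bonds of a chain joining y to y′) in the graph `bond` whose vertices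
are lattice points of T_η and whose edges are the admissible bonds (a contour retracing part of a bond only raises the
sum, so the infimum over the printed class equals the minimum over bond chains — this reduction is the content of the
dictionary and is NOT kernel-checked).  The typed carrier is therefore `ContourSystem g`: an abstract vertex type `Pt`,
a `SimpleGraph Pt` of admissible bonds, the inclusion `ι : 𝔅 → Pt` of the sibling carrier's sites, and the ZONE map
`zone : Pt → ℕ`, zone x = j iff x ∈ B^j(Λ_j) (the partition (2.4)), with zone (ι y) = j for y ∈ Λ_j (`B6.Geometry.scale`);
`dist246 C y y′ : ℕ := bond.dist (ι y) (ι y′)` is (2.46) (Mathlib `SimpleGraph.dist`, the least length of a walk); the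
printed *"Of course the infimum is attained at some contour"* presupposes that admissible contours joining any two points
EXIST — typed as the hypothesis `bond.Connected` wherever it is used (never asserted).  `Realizes g C` says that the
unspecified field `g.dist` of the sibling carrier IS this distance (cast to ℝ).
WHAT IS KERNEL-CHECKED.  (a) From `Realizes g C` (+ `Connected` for the triangle inequality): d(y, y) = 0
(`dist_self_of_realizes`), d ≥ 0 (`dist_nonneg_of_realizes`), d(y, y′) = d(y′, y) (`dist_comm_of_realizes`), the
triangle inequality (2.54) in the binary form `B6RandomWalk.Triangle254` (`triangle254_of_realizes`) and in the printed
n-point form (`ineq254_chain`, from the binary form alone) — i.e. EXACTLY the three hypotheses `htri`, `hrefl`, `hdnn` of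
`B6RandomWalk.majorant_of_fixedPoint_266` / `prop26_chain_2136` (`hyps266_of_realizes`), which are thereby discharged for
every geometry whose distance is (2.46) (`prop26_chain_2136_of_realizes`: the Prop. 2.6 chain with them and (2.63)
discharged, leaving (2.61), the located smallness θc₁ < 1 and the two input majorants).  (b) (2.60) ⇐ the WALK FORM of (2.2)/(2.57): in the pure graph section `Zoned`
the hypotheses are `bond.Connected` (admissible contours exist) and `LevelGap N` (every chain of admissible bonds from
a point of zone < i, i.e. of Ω_i^c by (2.4), to a point of zone > i, i.e. of Ω_{i+1}, has at least N + 1 bonds; with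
N = RM this is (2.2)/(2.57): such a chain crosses
Σ_i and then Σ_{i+1}, its portion between the two crossings lies in B^i(Λ_i), consists of Λ_i-bonds and has scaled
length (L^iη)^{−1}|·| > RM by (2.57), i.e. ≥ RM + 1 bonds — R *"a big positive integer"*, M the integer *"size of big
blocks"*); the separation property `Separates` (adjacent lattice points have zones differing by at most 1 — p. 231
*"The surface Σ_j separates the sets B^j(Λ_j) and B^{j−1}(Λ_{j−1})"*) FOLLOWS from it for N ≥ 1
(`separates_of_levelGap`), and we PROVE `levelGap_dist`: N·(|zone x − zone x′| − 1) ≤ bond.dist x x′, by the height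
function `height` = Σ_i min{N, (depth_i − 1)⁺} (depth_i x = least number of bonds from the zones < i to x; junk value 0
where those zones are empty, the admitted case Ω_j = T_η, p. 224), which is 1-Lipschitz along admissible bonds
(`abs_height_sub_le_one`) and gains N per zone strictly between zone x and zone x′ (`height_gain`); hence
`ineq260_of_levelGap : … → B6RandomWalk.Ineq260 g δ₀ α` for every α, δ₀ with 0 ≤ αδ₀ and g.R·g.M ≤ N, and
`lemma21Printed_of_ineq261`: for a family of geometries realized by contour systems satisfying the walk form of (2.2),
the sibling module's `B6.Lemma21Printed` ((2.60) ∧ (2.61)) FOLLOWS from (2.61) alone (`lemma21_full_of_ineq261` then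
gives (2.60)–(2.63) via `B6RandomWalk.lemma21_full`) — locating the analytic content of Lemma 2.1 in the lattice-point
count (2.58) ⇒ (2.61) (cell GAPS.md G-B6-04, constants reproduced in `…B6`).
WHAT IS *NOT* REPRODUCED OR ASSERTED: the metric fact (2.57) itself / condition (2.2) for the cubes of T_η (a statement
about the embedded big blocks — it enters as the hypothesis `LevelGap`), the surfaces Σ_j and the decomposition
(2.47)–(2.48) of a minimising contour (quoted above; replaced, for the purpose of (2.60), by the height-function
argument, which uses only the walk form of (2.57)), the comparison of d with the scaled euclidean distance (L^jη)^{−1}|y − y″| inside the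
range of one partition function ((2.66); cell GAPS.md G-pv08-1, still located), the lattice-point count (2.58) and
(2.61), and any identification of `Pt` with the sites of the tree's `Setup`/`TorusGeometry` tori (B12 conventions; B6
works on T_η with η = L^{−k}-type spacings and corner blocks — cell NOTATION.md).  NOTHING of the series is asserted; every
analytic or metric input is a hypothesis of the printed shape; value = typed vocabulary + kernel-checked bookkeeping, NOT
summit progress.  Unit `b2b-balaban-pv08-g2` (surge node prover #08, gen 2); cell records GAPS.md C-pv08g2-1 /
G-pv08g2-1, DIVERGENCE.md D-pv08g2.1.  v2 (append-only, same unit): §4 CARRIER-FREE forms `RealizedBy dist G ι` +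
`RealizedBy.dist_self/dist_nonneg/dist_comm/dist_triangle/exp_le_260` over raw (S, dist, scale) — the shape of the
hypotheses `hdist`/`hsym`/`htri`/`h260` of the tree's `B9Ineq349.ineq349_of_thms31to33` (B9 p. 399 (3.49) *"using again
Lemma 2.1"*, over `B9.Geometry`) and of the B10/B11 uses of the multiscale distance, so that those seats can discharge
them from a contour system on THEIR carrier without going through `B6.Geometry`.
-/

namespace Literature.MathematicalPhysics.QuantumFieldTheory.Balaban1983to89.B6Geometry

open Literature.MathematicalPhysics.QuantumFieldTheory.Balaban1983to89
open Finset

/-! ## 1. Walks in a zoned graph: the height function and the level-gap bound (pure combinatorics) -/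

section Zoned

variable {V : Type*} (G : SimpleGraph V) (zone : V → ℕ)

/-- p. 231 [9] *"The surface Σ_j separates the sets B^j(Λ_j) and B^{j−1}(Λ_{j−1})"* + *"a part of Γ contained in
B^j(Λ_j) consists of bonds of the lattice Λ_j"* (each admissible bond lies in one B^j(Λ_j), its end-points in that set or
on its bounding surfaces Σ_j, Σ_{j+1}), walk form: the zones of the two end-points of an admissible bond differ by at
most one. [cite: Balaban1984PropagatorsII, p.231] -/
def Separates : Prop :=
  ∀ ⦃u v : V⦄, G.Adj u v → zone v ≤ zone u + 1 ∧ zone u ≤ zone v + 1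

/-- Walk form of condition (2.2) p. 224 [2] *"(L^jη)^{−1} dist(Ω_j^c, Ω_{j+1}) > RM"* / (2.57) p. 233 [11]
*"(L^{j_{l,l+1}}η)^{−1}|y′_l − y_{l+1}| > RM"*: a chain of admissible bonds from a point of zone < i (outside Ω_i) to a
point of zone > i (inside Ω_{i+1}) has MORE than N bonds (N = RM, an integer). [cite: Balaban1984PropagatorsII, (2.2) p.224 + (2.57) p.233] -/
def LevelGap (N : ℕ) : Prop :=
  ∀ ⦃i : ℕ⦄ ⦃u x : V⦄, zone u < i → i < zone x → ∀ p : G.Walk u x, N + 1 ≤ p.length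

/-- depth_i(x): the least number of admissible bonds of a chain from the region of zones < i (= T∖Ω_i by (2.4)) to x
(junk value 0 if that region is empty, e.g. Ω_j = T_η for j ≤ l, p. 224). [folklore] -/
noncomputable def depth (i : ℕ) (x : V) : ℕ :=
  sInf {n : ℕ | ∃ u : V, zone u < i ∧ G.dist u x = n}

/-- The i-th collar coordinate min{N, (depth_i − 1)⁺} ∈ [0, N]. [folklore] -/
noncomputable def collar (N i : ℕ) (x : V) : ℕ :=
  min N (depth G zone i x - 1)

/-- The height function Σ_{i ≤ Z+1} min{N, (depth_i − 1)⁺} (any truncation Z): 1-Lipschitz along admissible bonds and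
gaining N per zone below Z + 2 — the potential behind (2.47)–(2.48) ⇒ (2.60). [folklore] -/
noncomputable def height (N Z : ℕ) (x : V) : ℤ :=
  ∑ i ∈ Finset.range (Z + 2), (collar G zone N i x : ℤ)

variable {G zone}

/-- For N ≥ 1 the level gap already forces the separation property (an admissible bond is a one-bond chain), so
`Separates` is never an extra hypothesis below; for N = 0 the level-gap bound is empty. [folklore] -/
theorem separates_of_levelGap {N : ℕ} (hgap : LevelGap G zone N) (hN : N ≠ 0) : Separates G zone := by
  intro u v huv
  constructor
  · by_contra h
    have h1 := hgap (i := zone u + 1) (u := u) (x := v) (by omega) (by omega)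
      (SimpleGraph.Walk.cons huv SimpleGraph.Walk.nil)
    rw [SimpleGraph.Walk.length_cons, SimpleGraph.Walk.length_nil] at h1
    omega
  · by_contra h
    have h1 := hgap (i := zone v + 1) (u := v) (x := u) (by omega) (by omega)
      (SimpleGraph.Walk.cons huv.symm SimpleGraph.Walk.nil)
    rw [SimpleGraph.Walk.length_cons, SimpleGraph.Walk.length_nil] at h1
    omega

/-- A point of zone < i has depth_i = 0. [folklore] -/
theorem depth_eq_zero_of_lt {i : ℕ} {x : V} (hx : zone x < i) : depth G zone i x = 0 := by
  have hmem : (0 : ℕ) ∈ {n : ℕ | ∃ u : V, zone u < i ∧ G.dist u x = n} := ⟨x, hx, SimpleGraph.dist_self⟩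
  exact Nat.eq_zero_of_le_zero (Nat.sInf_le hmem)

/-- If no point has zone < i, depth_i is the junk value 0 everywhere. [folklore] -/
theorem depth_eq_zero_of_none {i : ℕ} (h : ¬ ∃ w : V, zone w < i) (x : V) : depth G zone i x = 0 := by
  have hset : {n : ℕ | ∃ u : V, zone u < i ∧ G.dist u x = n} = ∅ := by
    ext n
    simp only [Set.mem_setOf_eq, Set.mem_empty_iff_false, iff_false]
    rintro ⟨u, hu, -⟩
    exact h ⟨u, hu⟩
  simp [depth, hset]

/-- If some point has zone < i, depth_i(x) is attained. [folklore] -/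
theorem depth_attained {i : ℕ} (h : ∃ w : V, zone w < i) (x : V) :
    ∃ u : V, zone u < i ∧ G.dist u x = depth G zone i x := by
  obtain ⟨w, hw⟩ := h
  have hne : ({n : ℕ | ∃ u : V, zone u < i ∧ G.dist u x = n} : Set ℕ).Nonempty := ⟨_, w, hw, rfl⟩
  exact Nat.sInf_mem hne

/-- depth_i is 1-Lipschitz along admissible bonds (triangle inequality of the graph distance). [folklore] -/
theorem depth_le_of_adj (hconn : G.Connected) {i : ℕ} {u v : V} (h : G.Adj u v) :
    depth G zone i v ≤ depth G zone i u + 1 := by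
  by_cases hex : ∃ w : V, zone w < i
  · obtain ⟨w, hw, hd⟩ := depth_attained hex u
    have htri : G.dist w v ≤ G.dist w u + G.dist u v := hconn.dist_triangle
    have h1 : G.dist u v = 1 := SimpleGraph.dist_eq_one_iff_adj.mpr h
    have hmem : G.dist w v ∈ {n : ℕ | ∃ u' : V, zone u' < i ∧ G.dist u' v = n} := ⟨w, hw, rfl⟩
    calc depth G zone i v ≤ G.dist w v := Nat.sInf_le hmem
      _ ≤ G.dist w u + G.dist u v := htri
      _ = depth G zone i u + 1 := by rw [hd, h1]
  · rw [depth_eq_zero_of_none hex, depth_eq_zero_of_none hex]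
    exact Nat.zero_le _

/-- The level gap in depth form: a point of zone > i is at depth_i ≥ N + 1 (when the zones < i are inhabited). [folklore] -/
theorem depth_ge_of_levelGap (hconn : G.Connected) {N i : ℕ} (hgap : LevelGap G zone N)
    (hex : ∃ w : V, zone w < i) {x : V} (hx : i < zone x) : N + 1 ≤ depth G zone i x := by
  obtain ⟨u, hu, hd⟩ := depth_attained hex x
  obtain ⟨p, hp⟩ := hconn.exists_walk_length_eq_dist u x
  have h := hgap hu hx p
  rwa [hp, hd] at h

/-- 0 ≤ collar ≤ N. [folklore] -/
theorem collar_le (N i : ℕ) (x : V) : collar G zone N i x ≤ N := min_le_left _ _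

/-- Below level i the i-th collar coordinate vanishes. [folklore] -/
theorem collar_eq_zero_of_lt {N i : ℕ} {x : V} (hx : zone x < i) : collar G zone N i x = 0 := by
  simp [collar, depth_eq_zero_of_lt hx]

/-- Junk case: no zones < i ⇒ the i-th collar coordinate vanishes identically. [folklore] -/
theorem collar_eq_zero_of_none {N i : ℕ} (h : ¬ ∃ w : V, zone w < i) (x : V) : collar G zone N i x = 0 := by
  simp [collar, depth_eq_zero_of_none h]

/-- Above level i the i-th collar coordinate is saturated (= N), by the level gap. [folklore] -/
theorem collar_eq_of_lt_zone (hconn : G.Connected) {N i : ℕ} (hgap : LevelGap G zone N)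
    (hex : ∃ w : V, zone w < i) {x : V} (hx : i < zone x) : collar G zone N i x = N := by
  have h := depth_ge_of_levelGap hconn hgap hex hx
  unfold collar
  exact min_eq_left (by omega)

/-- Along an admissible bond u — v with zone u ≤ zone v (≤ zone u + 1), every collar coordinate except the (zone u)-th
agrees at the two end-points. [folklore] -/
theorem collar_eq_of_adj_of_ne (hconn : G.Connected) {N : ℕ} (hgap : LevelGap G zone N) {u v : V}
    (huv : G.Adj u v) (hz : zone u ≤ zone v) (hz' : zone v ≤ zone u + 1) {i : ℕ} (hi : i ≠ zone u) :
    collar G zone N i u = collar G zone N i v := by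
  rcases Nat.lt_or_gt_of_ne hi with hlt | hgt
  · by_cases hex : ∃ w : V, zone w < i
    · rw [collar_eq_of_lt_zone hconn hgap hex hlt, collar_eq_of_lt_zone hconn hgap hex (lt_of_lt_of_le hlt hz)]
    · rw [collar_eq_zero_of_none hex, collar_eq_zero_of_none hex]
  · rw [collar_eq_zero_of_lt hgt]
    rcases lt_or_eq_of_le (show zone v ≤ i by omega) with hvl | hve
    · rw [collar_eq_zero_of_lt hvl]
    · have hdu : depth G zone i u = 0 := depth_eq_zero_of_lt hgt
      have hdv : depth G zone i v ≤ 1 := by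
        have h := depth_le_of_adj hconn (zone := zone) (i := i) huv
        rw [hdu] at h
        exact h
      unfold collar
      have h0 : depth G zone i v - 1 = 0 := by omega
      rw [h0]
      simp

/-- Along an admissible bond every single collar coordinate changes by at most one. [folklore] -/
theorem abs_collar_sub_le_one (hconn : G.Connected) {u v : V} (huv : G.Adj u v) (N i : ℕ) :
    |(collar G zone N i u : ℤ) - collar G zone N i v| ≤ 1 := by
  have h1 := depth_le_of_adj hconn (zone := zone) (i := i) huv
  have h2 := depth_le_of_adj hconn (zone := zone) (i := i) huv.symm
  unfold collar
  rw [abs_le]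
  constructor <;> push_cast [Nat.cast_min] <;> omega

/-- The height is 1-Lipschitz along admissible bonds (for every truncation Z of the sum). [folklore] -/
theorem abs_height_sub_le_one (hconn : G.Connected) {N : ℕ} (Z : ℕ) (hsep : Separates G zone)
    (hgap : LevelGap G zone N) {u v : V} (huv : G.Adj u v) :
    |height G zone N Z u - height G zone N Z v| ≤ 1 := by
  have key : ∀ {u v : V}, G.Adj u v → zone u ≤ zone v → zone v ≤ zone u + 1 →
      |height G zone N Z u - height G zone N Z v| ≤ 1 := by
    intro u v huv hz hz'
    unfold height
    rw [← Finset.sum_sub_distrib]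
    by_cases hmem : zone u ∈ Finset.range (Z + 2)
    · rw [Finset.sum_eq_single_of_mem (zone u) hmem]
      · exact abs_collar_sub_le_one hconn huv N (zone u)
      · intro i _ hi
        rw [collar_eq_of_adj_of_ne hconn hgap huv hz hz' hi, sub_self]
    · rw [Finset.sum_eq_zero]
      · simp
      · intro i hi
        have hne : i ≠ zone u := fun h => hmem (h ▸ hi)
        rw [collar_eq_of_adj_of_ne hconn hgap huv hz hz' hne, sub_self]
  rcases le_total (zone u) (zone v) with h | h
  · exact key huv h (hsep huv).1
  · rw [abs_sub_comm]
    exact key huv.symm h (hsep huv).2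

/-- Along a chain of admissible bonds the height changes by at most the number of bonds. [folklore] -/
theorem abs_height_sub_le_length (hconn : G.Connected) {N : ℕ} (Z : ℕ) (hsep : Separates G zone)
    (hgap : LevelGap G zone N) {x y : V} (p : G.Walk x y) :
    |height G zone N Z x - height G zone N Z y| ≤ p.length := by
  induction p with
  | nil => simp
  | @cons a b c hab p ih =>
    calc |height G zone N Z a - height G zone N Z c|
        ≤ |height G zone N Z a - height G zone N Z b| + |height G zone N Z b - height G zone N Z c| :=
          abs_sub_le _ _ _
      _ ≤ 1 + (p.length : ℤ) := add_le_add (abs_height_sub_le_one hconn Z hsep hgap hab) ih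
      _ = ((SimpleGraph.Walk.cons hab p).length : ℤ) := by
          rw [SimpleGraph.Walk.length_cons]; push_cast; ring

/-- Hence by at most the distance. [folklore] -/
theorem abs_height_sub_le_dist (hconn : G.Connected) {N : ℕ} (Z : ℕ) (hsep : Separates G zone)
    (hgap : LevelGap G zone N) (x y : V) :
    |height G zone N Z x - height G zone N Z y| ≤ G.dist x y := by
  obtain ⟨p, hp⟩ := hconn.exists_walk_length_eq_dist x y
  rw [← hp]
  exact abs_height_sub_le_length hconn Z hsep hgap p

/-- The height (truncated at any Z ≥ zone x′ − 2) gains at least N per zone strictly between zone x and zone x′.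
[folklore] -/
theorem height_gain (hconn : G.Connected) {N Z : ℕ} (hgap : LevelGap G zone N)
    {x x' : V} (hlt : zone x < zone x') (hZ : zone x' ≤ Z + 2) :
    (N : ℤ) * ((zone x' - zone x - 1 : ℕ) : ℤ) ≤ height G zone N Z x' - height G zone N Z x := by
  unfold height
  rw [← Finset.sum_sub_distrib]
  have key : ∀ i ∈ Finset.range (Z + 2),
      (if i ∈ Finset.Ioo (zone x) (zone x') then (N : ℤ) else 0) ≤
        (collar G zone N i x' : ℤ) - collar G zone N i x := by
    intro i _
    by_cases hi : i ∈ Finset.Ioo (zone x) (zone x')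
    · rw [if_pos hi]
      obtain ⟨h1, h2⟩ := Finset.mem_Ioo.mp hi
      rw [collar_eq_zero_of_lt h1, collar_eq_of_lt_zone hconn hgap ⟨x, h1⟩ h2]
      simp
    · rw [if_neg hi]
      rcases lt_or_ge i (zone x') with h2 | h2
      · by_cases hex : ∃ w : V, zone w < i
        · rw [collar_eq_of_lt_zone hconn hgap hex h2]
          have := collar_le (G := G) (zone := zone) N i x
          omega
        · rw [collar_eq_zero_of_none hex, collar_eq_zero_of_none hex]
          simp
      · rw [collar_eq_zero_of_lt (lt_of_lt_of_le hlt h2)]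
        simp
  calc (N : ℤ) * ((zone x' - zone x - 1 : ℕ) : ℤ)
      = ∑ i ∈ Finset.range (Z + 2), (if i ∈ Finset.Ioo (zone x) (zone x') then (N : ℤ) else 0) := by
        rw [Finset.sum_ite_mem, Finset.sum_const, nsmul_eq_mul]
        have hsub : Finset.Ioo (zone x) (zone x') ⊆ Finset.range (Z + 2) := by
          intro i hi
          rw [Finset.mem_Ioo] at hi
          exact Finset.mem_range.mpr (by omega)
        rw [Finset.inter_eq_right.mpr hsub, Nat.card_Ioo, mul_comm]
    _ ≤ ∑ i ∈ Finset.range (Z + 2), ((collar G zone N i x' : ℤ) - collar G zone N i x) := Finset.sum_le_sum key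

/-- **The level-gap bound** (the combinatorial content of (2.47)–(2.48) + (2.57) ⇒ (2.60)): if every chain of admissible
bonds from a point of zone < i to a point of zone > i has more than N bonds (each i), then any two points x, x′ are at
least N·(|zone x − zone x′| − 1) bonds apart. [cite: Balaban1984PropagatorsII, (2.47)–(2.48) pp.231–232 + (2.57) p.233 + (2.60) p.234] -/
theorem levelGap_dist (hconn : G.Connected) {N : ℕ} (hgap : LevelGap G zone N)
    {x x' : V} (hlt : zone x < zone x') :
    N * (zone x' - zone x - 1) ≤ G.dist x x' := by
  rcases Nat.eq_zero_or_pos N with hN | hN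
  · subst hN
    simp
  have hsep : Separates G zone := separates_of_levelGap hgap (by omega)
  have h1 := height_gain hconn hgap hlt (Z := zone x') (by omega)
  have h2 := abs_height_sub_le_dist hconn (zone x') hsep hgap x' x (N := N)
  have h3 : height G zone N (zone x') x' - height G zone N (zone x') x ≤ (G.dist x x' : ℤ) := by
    rw [SimpleGraph.dist_comm]
    exact le_trans (le_abs_self _) h2
  exact_mod_cast le_trans h1 h3

/-- The level-gap bound in the symmetric real form used by (2.60): N·max{|zone x − zone x′| − 1, 0} ≤ dist(x, x′). [folklore] -/
theorem levelGap_dist_real (hconn : G.Connected) {N : ℕ} (hgap : LevelGap G zone N) (x x' : V) :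
    (N : ℝ) * max (|(zone x : ℝ) - zone x'| - 1) 0 ≤ (G.dist x x' : ℝ) := by
  rcases lt_trichotomy (zone x) (zone x') with h | h | h
  · have hle := levelGap_dist hconn hgap h (N := N)
    have hcast : ((zone x' - zone x - 1 : ℕ) : ℝ) = (zone x' : ℝ) - zone x - 1 := by
      rw [Nat.cast_sub (by omega), Nat.cast_sub (le_of_lt h)]
      push_cast; ring
    have hlt' : (zone x : ℝ) < zone x' := by exact_mod_cast h
    have habs : |(zone x : ℝ) - zone x'| = (zone x' : ℝ) - zone x := by
      rw [abs_sub_comm]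
      exact abs_of_pos (by linarith)
    have hmax : max (|(zone x : ℝ) - zone x'| - 1) 0 = ((zone x' - zone x - 1 : ℕ) : ℝ) := by
      rw [habs, hcast]
      exact max_eq_left (by
        have : (zone x : ℝ) + 1 ≤ zone x' := by exact_mod_cast h
        linarith)
    rw [hmax]
    exact_mod_cast hle
  · rw [h, sub_self, abs_zero]
    have : max ((0 : ℝ) - 1) 0 = 0 := max_eq_right (by norm_num)
    rw [this, mul_zero]
    exact Nat.cast_nonneg _
  · have hle := levelGap_dist hconn hgap h (N := N)
    have hcast : ((zone x - zone x' - 1 : ℕ) : ℝ) = (zone x : ℝ) - zone x' - 1 := by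
      rw [Nat.cast_sub (by omega), Nat.cast_sub (le_of_lt h)]
      push_cast; ring
    have habs : |(zone x : ℝ) - zone x'| = (zone x : ℝ) - zone x' :=
      abs_of_pos (by
        have : (zone x' : ℝ) < zone x := by exact_mod_cast h
        linarith)
    have hmax : max (|(zone x : ℝ) - zone x'| - 1) 0 = ((zone x - zone x' - 1 : ℕ) : ℝ) := by
      rw [habs, hcast]
      exact max_eq_left (by
        have : (zone x' : ℝ) + 1 ≤ zone x := by exact_mod_cast h
        linarith)
    rw [hmax, SimpleGraph.dist_comm]
    exact_mod_cast hle

end Zoned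

/-! ## 2. The multiscale distance (2.46) of a contour system and the hypotheses of `B6RandomWalk` discharged -/

/-- The typed carrier of definition (2.46) p. 231 [9] over ONE abstract multiscale geometry `g` of the sibling module
(𝔅 = `g.Site`, j = `g.scale`): the lattice points `Pt` of T_η through which contours run, the graph `bond` of
ADMISSIBLE BONDS (*"a part of Γ contained in B^j(Λ_j) consists of bonds of the lattice Λ_j"*; each such bond contributes
exactly 1 to Σ_j (L^jη)^{−1}|Γ ∩ B^j(Λ_j)|), the inclusion `ι` of 𝔅 = ⋃_{j=0}^k Λ_j (2.45) into the lattice points, and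
the zone map (x ∈ B^{zone x}(Λ_{zone x}), the partition (2.4) *"T = ⋃_{j=0}^k B^j(Λ_j)"*), with zone (ι y) = j for
y ∈ Λ_j (`g.scale`). [cite: Balaban1984PropagatorsII, (2.4) p.224 + (2.45)–(2.46) p.231] -/
structure ContourSystem (g : B6.Geometry) where
  /-- lattice points of T_η (vertices of contours) -/
  Pt : Type
  /-- the admissible bonds -/
  bond : SimpleGraph Pt
  /-- 𝔅 ⊂ T_η -/
  ι : g.Site → Pt
  /-- x ∈ B^{zone x}(Λ_{zone x}) -/
  zone : Pt → ℕ
  /-- y ∈ Λ_j lies in B^j(Λ_j): zone (ι y) = j -/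
  zone_ι : ∀ y : g.Site, zone (ι y) = g.scale y

variable {g : B6.Geometry}

/-- **(2.46)** (p. 231 [9]), typed: d(y, y′) = the least number of admissible bonds of a contour joining y to y′
(= inf_Γ Σ_{j=0}^k (L^jη)^{−1}|Γ_{y,y′} ∩ B^j(Λ_j)|, see the module docstring for the dictionary; Mathlib
`SimpleGraph.dist`, value 0 if no contour exists — excluded by `bond.Connected` wherever used). [cite: Balaban1984PropagatorsII, (2.46) p.231] -/
noncomputable def dist246 (C : ContourSystem g) (y y' : g.Site) : ℕ :=
  C.bond.dist (C.ι y) (C.ι y')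

/-- p. 231 [9], the extended definition, verbatim: *"d(x, x′) = d(y^j(x), y^{j′}(x′)) if x ∈ B^j(Λ_j), x′ ∈ B^{j′}(Λ_{j′})"*
— for points of an abstract lattice `X` with block-label map `blk : X → 𝔅` (x ∈ B^j(blk x), as in
`B6RandomWalk.HasMajorant`). [cite: Balaban1984PropagatorsII, p.231] -/
noncomputable def distExt (C : ContourSystem g) {X : Type} (blk : X → g.Site) (x x' : X) : ℕ :=
  dist246 C (blk x) (blk x')

/-- "The unspecified distance field of the sibling carrier `g : B6.Geometry` IS the multiscale distance (2.46) of the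
contour system C." [cite: Balaban1984PropagatorsII, (2.46) p.231] -/
def Realizes (g : B6.Geometry) (C : ContourSystem g) : Prop :=
  ∀ y y' : g.Site, g.dist y y' = (dist246 C y y' : ℝ)

/-- d(y, y) = 0 (the trivial contour) — hypothesis `hrefl` of `B6RandomWalk.majorant_pow_265` /
`majorant_of_fixedPoint_266` / `prop26_chain_2136`, DISCHARGED. [cite: Balaban1984PropagatorsII, (2.46) p.231] -/
theorem dist_self_of_realizes {C : ContourSystem g} (h : Realizes g C) (y : g.Site) : g.dist y y = 0 := by
  rw [h y y, dist246, SimpleGraph.dist_self, Nat.cast_zero]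

/-- d ≥ 0 — hypothesis `hdnn` of `B6RandomWalk.majorant_of_fixedPoint_266` / `prop26_chain_2136`, DISCHARGED.
[cite: Balaban1984PropagatorsII, (2.46) p.231] -/
theorem dist_nonneg_of_realizes {C : ContourSystem g} (h : Realizes g C) (y y' : g.Site) : 0 ≤ g.dist y y' := by
  rw [h y y']
  exact Nat.cast_nonneg _

/-- d(y, y′) = d(y′, y) (reverse the contour). [cite: Balaban1984PropagatorsII, (2.46) p.231] -/
theorem dist_comm_of_realizes {C : ContourSystem g} (h : Realizes g C) (y y' : g.Site) : g.dist y y' = g.dist y' y := by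
  rw [h y y', h y' y, dist246, dist246, SimpleGraph.dist_comm]

/-- **(2.54)** KERNEL-CHECKED from the definition (2.46) (p. 233 [11]: *"Taking the contour Γ_{y,y′} = ⋃ Γ_{y_i,y_{i+1}}
… we obtain an admissible contour with end-points y, y′, hence by definition (2.46) … This is of course the triangle
inequality for our distance"*): the binary form `B6RandomWalk.Triangle254` — hypothesis `htri` of `B6RandomWalk.ineq263_of_261`,
`lemma21_full`, `majorant_partialSum_266`, `majorant_of_fixedPoint_266`, `prop26_chain_2136`, DISCHARGED (given that
admissible contours exist, `bond.Connected`). [cite: Balaban1984PropagatorsII, (2.54) p.233] -/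
theorem triangle254_of_realizes {C : ContourSystem g} (h : Realizes g C) (hconn : C.bond.Connected) :
    B6RandomWalk.Triangle254 g := by
  intro a b c
  rw [h a c, h a b, h b c, dist246, dist246, dist246]
  exact_mod_cast hconn.dist_triangle

/-- The left-hand side of the printed (2.54): d(y, y₁) + d(y₁, y₂) + … + d(y_{n−1}, y′) for the intermediate points
(y₁, …, y_{n−1}) given as a list. [cite: Balaban1984PropagatorsII, (2.54) p.233] -/
def chainLength (dist : g.Site → g.Site → ℝ) : g.Site → List g.Site → g.Site → ℝ
  | y, [], y' => dist y y'
  | y, z :: l, y' => dist y z + chainLength dist z l y'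

/-- **(2.54)** in its printed n-point form, from the binary triangle inequality: *"d(y, y₁) + d(y₁, y₂) + … +
d(y_{n−1}, y′) ≥ d(y, y′). (2.54)"* [cite: Balaban1984PropagatorsII, (2.54) p.233] -/
theorem ineq254_chain (htri : B6RandomWalk.Triangle254 g) (y : g.Site) (l : List g.Site) (y' : g.Site) :
    g.dist y y' ≤ chainLength g.dist y l y' := by
  induction l generalizing y with
  | nil => exact le_rfl
  | cons z l ih =>
    calc g.dist y y' ≤ g.dist y z + g.dist z y' := htri y z y'
      _ ≤ g.dist y z + chainLength g.dist z l y' := by linarith [ih z]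
      _ = chainLength g.dist y (z :: l) y' := rfl

/-- The three standing hypotheses `htri`, `hrefl`, `hdnn` of the sibling module's kernel chains
(`B6RandomWalk.majorant_of_fixedPoint_266`, `prop26_chain_2136`; cell GAPS.md G-pv08-2 (ii)) hold for every geometry
whose distance is (2.46). [cite: Balaban1984PropagatorsII, (2.46) p.231 + (2.54) p.233] -/
theorem hyps266_of_realizes {C : ContourSystem g} (h : Realizes g C) (hconn : C.bond.Connected) :
    B6RandomWalk.Triangle254 g ∧ (∀ y : g.Site, g.dist y y = 0) ∧ (∀ y y' : g.Site, 0 ≤ g.dist y y') :=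
  ⟨triangle254_of_realizes h hconn, dist_self_of_realizes h, dist_nonneg_of_realizes h⟩

/-! ## 3. (2.60) from the walk form of (2.2), and Lemma 2.1 from (2.61) alone -/

/-- **(2.60)** KERNEL-DERIVED (p. 234 [12]: *"e^{−αδ₀d(y,y′)} ≤ e^{−αδ₀RM max{|j−j′|−1,0}}, y ∈ Λ_j, y′ ∈ Λ_{j′},
(2.60)"*): for a geometry whose distance is (2.46), with admissible contours existing and the walk form `LevelGap N`
of condition (2.2)/(2.57) with N ≥ RM (N = RM when RM ∈ ℕ — R *"a big positive integer"*, M the block size),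
(2.60) holds for every α, δ₀ with αδ₀ ≥ 0 (no condition (2.59), no α < 1 needed for this half). [cite: Balaban1984PropagatorsII, (2.60) p.234 + (2.2) p.224 + (2.57) p.233] -/
theorem ineq260_of_levelGap {C : ContourSystem g} (h : Realizes g C) (hconn : C.bond.Connected)
    {N : ℕ} (hgap : LevelGap C.bond C.zone N) (hRM : g.R * g.M ≤ N)
    {δ₀ α : ℝ} (hαδ : 0 ≤ α * δ₀) : B6RandomWalk.Ineq260 g δ₀ α := by
  intro y y'
  have hd := levelGap_dist_real hconn hgap (C.ι y) (C.ι y') (N := N)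
  rw [C.zone_ι y, C.zone_ι y'] at hd
  have hmax : 0 ≤ max (|(g.scale y : ℝ) - g.scale y'| - 1) 0 := le_max_right _ _
  have hd' : g.R * g.M * max (|(g.scale y : ℝ) - g.scale y'| - 1) 0 ≤ g.dist y y' := by
    rw [h y y', dist246]
    exact le_trans (mul_le_mul_of_nonneg_right hRM hmax) hd
  apply Real.exp_le_exp.mpr
  have := mul_le_mul_of_nonneg_left hd' hαδ
  nlinarith [this]

/-- **Lemma 2.1 from (2.61) alone.**  For a family of geometries each realized by a contour system with admissible
contours existing and satisfying the walk form of (2.2) with N_i ≥ R_iM_i bonds, the sibling module's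
`B6.Lemma21Printed` (= (2.60) ∧ (2.61) under (2.1)–(2.2), 0 < α < 1, (2.59)) FOLLOWS from (2.61) (`B6RandomWalk.Ineq261`)
under the same conditions (δ₀ ≥ 0, the decay rate of Prop. 2.2): the analytic content of Lemma 2.1 is the
lattice-point count (2.58) ⇒ (2.61) only. [cite: Balaban1984PropagatorsII, Lemma 2.1 p.234] -/
theorem lemma21Printed_of_ineq261 {I : Type} (d : ℕ) (δ₀ : ℝ) (hδ : 0 ≤ δ₀) (geo : I → B6.Geometry)
    (C : ∀ i, ContourSystem (geo i)) (N : I → ℕ)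
    (hreal : ∀ i, Realizes (geo i) (C i)) (hconn : ∀ i, (C i).bond.Connected)
    (hgap : ∀ i, LevelGap (C i).bond (C i).zone (N i))
    (hRM : ∀ i, (geo i).R * (geo i).M ≤ N i)
    (h261 : ∀ i : I, (geo i).Hyp21_22 → ∀ α : ℝ, 0 < α → α < 1 →
      B6.Cond259 d δ₀ α (geo i).R (geo i).M → B6RandomWalk.Ineq261 d (geo i) δ₀ α) :
    B6.Lemma21Printed d δ₀ geo := by
  rw [B6RandomWalk.lemma21Printed_iff]
  intro i hH α hα0 hα1 hcond
  exact ⟨ineq260_of_levelGap (hreal i) (hconn i) (hgap i) (hRM i) (mul_nonneg hα0.le hδ),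
    h261 i hH α hα0 hα1 hcond⟩

/-- COROLLARY (all four displays of Lemma 2.1 for such a family, from (2.61) alone): plug `lemma21Printed_of_ineq261`
and `triangle254_of_realizes` into the sibling module's `B6RandomWalk.lemma21_full`. [cite: Balaban1984PropagatorsII, Lemma 2.1 (2.60)–(2.63) p.234] -/
theorem lemma21_full_of_ineq261 {I : Type} (d : ℕ) (δ₀ : ℝ) (hδ : 0 ≤ δ₀) (geo : I → B6.Geometry)
    (C : ∀ i, ContourSystem (geo i)) (N : I → ℕ)
    (hreal : ∀ i, Realizes (geo i) (C i)) (hconn : ∀ i, (C i).bond.Connected)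
    (hgap : ∀ i, LevelGap (C i).bond (C i).zone (N i))
    (hRM : ∀ i, (geo i).R * (geo i).M ≤ N i)
    (h261 : ∀ i : I, (geo i).Hyp21_22 → ∀ α : ℝ, 0 < α → α < 1 →
      B6.Cond259 d δ₀ α (geo i).R (geo i).M → B6RandomWalk.Ineq261 d (geo i) δ₀ α) :
    ∀ i : I, (geo i).Hyp21_22 → ∀ α : ℝ, 0 < α → α < 1 → B6.Cond259 d δ₀ α (geo i).R (geo i).M →
      B6RandomWalk.Ineq260 (geo i) δ₀ α ∧ B6RandomWalk.Ineq261 d (geo i) δ₀ α ∧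
        B6RandomWalk.Ineq262 d (geo i) δ₀ α ∧ B6RandomWalk.Ineq263 d (geo i) δ₀ α :=
  B6RandomWalk.lemma21_full d δ₀ hδ geo (fun i => triangle254_of_realizes (hreal i) (hconn i))
    (lemma21Printed_of_ineq261 d δ₀ hδ geo C N hreal hconn hgap hRM h261)

/-- **The Prop. 2.6 chain with its geometric hypotheses discharged**: the sibling module's
`B6RandomWalk.prop26_chain_2136` ((2.51)-type majorants + the fixed-point identity ⇒ the (2.136) majorant) for a
geometry realized by a contour system with admissible contours existing — `htri`, `hrefl`, `hdnn` supplied by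
`triangle254_of_realizes`, `dist_self_of_realizes`, `dist_nonneg_of_realizes`, and (2.63) by
`B6RandomWalk.ineq263_of_261`; the only remaining analytic inputs are (2.61) at decay rate ½δ₂, the located smallness
θc₁ < 1, and the two input majorants. [cite: Balaban1984PropagatorsII, Prop. 2.6 (2.136) p.247 + (2.46) p.231] -/
theorem prop26_chain_2136_of_realizes {X : Type} [Fintype X] [DecidableEq X] {C : ContourSystem g}
    (hC : Realizes g C) (hconn : C.bond.Connected) (blk : X → g.Site) (d : ℕ) (δ₂ α θ A : ℝ)
    (P : g.Site → ℝ) (hA : 0 ≤ A) (hP : ∀ y, 0 ≤ P y) (hθ : 0 ≤ θ) (hα : α ≤ 1) (hδ₂ : 0 ≤ δ₂)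
    (h261 : B6RandomWalk.Ineq261 d g (δ₂ / 2) α) (hsmall : θ * B6.c1 d (δ₂ / 2) α < 1)
    {G G0 R : Module.End ℝ (X → ℝ)}
    (hG0 : B6RandomWalk.HasMajorant blk G0 (fun a b => A * P a * Real.exp (-(δ₂ / 2 * g.dist a b))))
    (hR : B6RandomWalk.HasMajorant blk R (fun a b => θ * Real.exp (-(δ₂ / 2 * g.dist a b))))
    (hfix : G = G0 + G * R) :
    B6RandomWalk.HasMajorant blk G (fun a b =>
      B6RandomWalk.const2136 d δ₂ α θ A * P a * Real.exp (-(B6RandomWalk.delta3 α δ₂ * g.dist a b))) :=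
  B6RandomWalk.prop26_chain_2136 blk d δ₂ α θ A P hA hP hθ hα hδ₂ (triangle254_of_realizes hC hconn)
    (dist_self_of_realizes hC) (dist_nonneg_of_realizes hC) h261
    (B6RandomWalk.ineq263_of_261 d g (δ₂ / 2) α (triangle254_of_realizes hC hconn) (by linarith) hα h261)
    hsmall hG0 hR hfix

/-! ## 4. Carrier-free forms (v2, append-only)

The facts of §§2–3 over RAW data — a site type `S`, a distance `dist : S → S → ℝ` and a scale map
`scale : S → ℕ` realised by a zoned graph — i.e. in the shape in which the LATER papers consume Lemma 2.1 of [4] = B6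
on their own carriers, whose fields carry the same names `dist`, `scale`, `M`: B9 (CMP 99) p. 399 (3.49) *"using again
Lemma 2.1"* — the tree's `B9Ineq349.ineq349_of_thms31to33` takes `hdist : ∀ y y', 0 ≤ g.dist y y'`,
`hsym : ∀ y y', g.dist y y' = g.dist y' y`, `htri : ∀ a b c, g.dist a c ≤ g.dist a b + g.dist b c` and
`h260 : ∀ y y', exp(−(α·δ·g.dist y y′)) ≤ exp(−(α·δ·R·g.M·max(|scale y − scale y′| − 1, 0)))` over `B9.Geometry`
(B9 p. 393 adopts the domains (2.1)–(2.2) of [4] with Ω₀ prepended) — and likewise the multiscale distances of B10/B11.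
With `RealizedBy dist G ι` these four hypotheses are `RealizedBy.dist_nonneg`, `.dist_comm`, `.dist_triangle` and
`.exp_le_260` (ε := αδ); nothing here mentions `B6.Geometry`. [cite: Balaban1984PropagatorsII, (2.46) p.231, (2.54)
p.233, (2.60) p.234] -/

section CarrierFree

variable {S V : Type*} (dist : S → S → ℝ) (G : SimpleGraph V) (ι : S → V)

/-- Carrier-free `Realizes`: the distance `dist` on the sites `S` IS the admissible-bond graph distance (2.46) of the
zoned graph `G` through the inclusion `ι`. [cite: Balaban1984PropagatorsII, (2.46) p.231] -/
def RealizedBy : Prop :=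
  ∀ y y' : S, dist y y' = (G.dist (ι y) (ι y') : ℝ)

variable {dist G ι}

/-- `Realizes g C` is `RealizedBy g.dist C.bond C.ι`. [cite: Balaban1984PropagatorsII, (2.46) p.231] -/
theorem realizedBy_of_realizes {g : B6.Geometry} {C : ContourSystem g} (h : Realizes g C) :
    RealizedBy g.dist C.bond C.ι :=
  fun y y' => h y y'

/-- d(y, y) = 0. [cite: Balaban1984PropagatorsII, (2.46) p.231] -/
theorem RealizedBy.dist_self (h : RealizedBy dist G ι) (y : S) : dist y y = 0 := by
  rw [h y y, SimpleGraph.dist_self, Nat.cast_zero]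

/-- d ≥ 0 (B9 `hdist`). [cite: Balaban1984PropagatorsII, (2.46) p.231] -/
theorem RealizedBy.dist_nonneg (h : RealizedBy dist G ι) (y y' : S) : 0 ≤ dist y y' := by
  rw [h y y']
  exact Nat.cast_nonneg _

/-- d(y, y′) = d(y′, y) (B9 `hsym`). [cite: Balaban1984PropagatorsII, (2.46) p.231] -/
theorem RealizedBy.dist_comm (h : RealizedBy dist G ι) (y y' : S) : dist y y' = dist y' y := by
  rw [h y y', h y' y, SimpleGraph.dist_comm]

/-- (2.54), binary form (B9 `htri`), given that admissible contours exist. [cite: Balaban1984PropagatorsII, (2.54) p.233] -/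
theorem RealizedBy.dist_triangle (h : RealizedBy dist G ι) (hconn : G.Connected) (a b c : S) :
    dist a c ≤ dist a b + dist b c := by
  rw [h a c, h a b, h b c]
  exact_mod_cast hconn.dist_triangle

/-- **(2.60), carrier-free** (B9 `h260` with ε := αδ): for a distance realised by a connected zoned graph satisfying
the walk form `LevelGap N` of (2.2)/(2.57), R·M ≤ N and ε ≥ 0,
e^{−ε d(y,y′)} ≤ e^{−ε RM max{|j−j′|−1, 0}}, y ∈ Λ_j, y′ ∈ Λ_{j′}. [cite: Balaban1984PropagatorsII, (2.60) p.234 + (2.2) p.224 + (2.57) p.233] -/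
theorem RealizedBy.exp_le_260 (h : RealizedBy dist G ι) (hconn : G.Connected) {zone : V → ℕ} {scale : S → ℕ}
    (hzone : ∀ y : S, zone (ι y) = scale y) {N : ℕ} (hgap : LevelGap G zone N) {R M ε : ℝ} (hRM : R * M ≤ N)
    (hε : 0 ≤ ε) (y y' : S) :
    Real.exp (-(ε * dist y y')) ≤ Real.exp (-(ε * R * M * max (|(scale y : ℝ) - (scale y' : ℝ)| - 1) 0)) := by
  have hd := levelGap_dist_real hconn hgap (ι y) (ι y') (N := N)
  rw [hzone y, hzone y'] at hd
  have hmax : 0 ≤ max (|(scale y : ℝ) - (scale y' : ℝ)| - 1) 0 := le_max_right _ _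
  have hd' : R * M * max (|(scale y : ℝ) - (scale y' : ℝ)| - 1) 0 ≤ dist y y' := by
    rw [h y y']
    exact le_trans (mul_le_mul_of_nonneg_right hRM hmax) hd
  apply Real.exp_le_exp.mpr
  have := mul_le_mul_of_nonneg_left hd' hε
  nlinarith [this]

/-- The lattice-point SUM shape of (2.61)/(2.58) is untouched by the dictionary: it is recorded here only as the one
remaining geometric-analytic input (`B6RandomWalk.Ineq261` on the B6 carrier; B9 `h261`). For the record, the
carrier-free (2.60) gives the B6-carrier one back. [cite: Balaban1984PropagatorsII, (2.60) p.234] -/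
theorem ineq260_of_realizedBy {g : B6.Geometry} {C : ContourSystem g} (h : Realizes g C) (hconn : C.bond.Connected)
    {N : ℕ} (hgap : LevelGap C.bond C.zone N) (hRM : g.R * g.M ≤ N) {δ₀ α : ℝ} (hαδ : 0 ≤ α * δ₀) :
    B6RandomWalk.Ineq260 g δ₀ α := fun y y' =>
  (realizedBy_of_realizes h).exp_le_260 hconn C.zone_ι hgap hRM hαδ y y'

end CarrierFree

end Literature.MathematicalPhysics.QuantumFieldTheory.Balaban1983to89.B6Geometry
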